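import Literature.Geometry.Lorentzian.CarterSliverSmallness
import HarnessLib

/-!
# The cap smallness conditions of the threshold sliver from `ξ₁ ≤ 10⁻¹⁸θ₁⁴min(θ, 1)`
(namespace `Literature.Geometry.Lorentzian.Kerr`.)

Continuation of `CarterSliverSmallness`: the seven cap hypotheses of
`CarterSliverRegimeKernel.sliverRegime_kernel_le` (`2X* ≤ θ(r₊ − r₋)`, `X* ≤ r₊ − r₋`, the
`K`-condition `6r₊|ω|X_low ≤ (r₊² + a²)|σ|`, `A_cap X* ≤ 1`, `8ε_c² ≤ 131072X*(r₊ − r₋)θ₁Λ′/(16C_A²)`,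
`r₃ ≤ r₊ + min(r₊ − r₋, θ₁r₊/8)`, `r₃ ≤ r₊ + θ(r₊ − r₋)`) hold in the sliver `0 < |σ| ≤ 2ξ₁κ` with
`ξ₁ ≤ 10⁻¹⁸θ₁⁴min(θ, 1)` for every admissible cone frequency with `0 < m` and BF margin `θ₁ ∈ (0, 1]`:

* `sliver_cap_small`.

With `T := (r₊² + a²)|σ| ≤ ξ₁(r₊ − r₋)`: `X* = 24T²/((r₊ − r₋)θ₁²Λ′)`, `X_low = T²/(8(r₊ − r₋)(|Λ′| + 3))`,
`C_cap ≤ 43Λ`, `ε_c ≤ 6|σ|`, `C_A ≤ 5(r₊² + a²)`, `r₃ − r₊ ≤ 6·10⁻¹³θ₁³min(θ, 1)(r₊ − r₋)`.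
Near-extremal Kerr programme, crux `KappaExplicitWaveDecay`. Folklore arithmetic.

## References
* M. Dafermos, I. Rodnianski, Y. Shlapentokh-Rothman, arXiv:1402.7034 = Ann. of Math. 183 (2016),
  §8 (key `DafermosRodnianskiShlapentokhrothman2014`).
-/

noncomputable section

open Set

namespace Literature.Geometry.Lorentzian

namespace Kerr

section SliverCapSmallness

variable {M a ω Λ θ θ₁ ξ₁ ε₀ : ℝ} {m : ℤ}

set_option maxHeartbeats 400000 in
-- seven elementary conditions sharing one preamble
/-- **The cap conditions of the sliver.** Under the atoms' hypotheses with `0 < θ`, `0 < θ₁ ≤ 1`,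
`ξ₁ ≤ 10⁻¹⁸θ₁⁴` and `ξ₁ ≤ 10⁻¹⁸θ₁⁴θ`, `σ ≠ 0`: the seven cap hypotheses of `sliverRegime_kernel_le`
(abbreviations as equations). [folklore] -/
theorem sliver_cap_small (hMa : IsSubextremal M a) (ha : M / 2 ≤ |a|) (hadm : IsAdmissibleTriple a ω m Λ)
    (hm : 0 < m) (hε₀ : ε₀ ≤ 1 / (16 * M)) (hcone : |ω - m * horizonAngularVelocity M a| ≤ ε₀ * |(m : ℝ)|)
    (hθ : 0 < θ) (hθ₁ : 0 < θ₁) (hθ₁1 : θ₁ ≤ 1)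
    (hBF : (1 + θ₁) * (2 * rPlus M a * ω) ^ 2 ≤ Λ - 2 * a * m * ω)
    (hξ₁ : 0 ≤ ξ₁) (hξ₁le : ξ₁ ≤ 1e-18 * θ₁ ^ 4) (hξ₁θ : ξ₁ ≤ 1e-18 * θ₁ ^ 4 * θ)
    (hσ0 : ω - m * horizonAngularVelocity M a ≠ 0)
    (hσ : |ω - m * horizonAngularVelocity M a| ≤ 2 * ξ₁ * surfaceGravity M a)
    {Xs Xl Ccap Acap εc CA cQ r₃ : ℝ}
    (hXs : Xs = 24 * ((rPlus M a ^ 2 + a ^ 2) * (ω - m * horizonAngularVelocity M a)) ^ 2 /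
      ((rPlus M a - rMinus M a) * θ₁ ^ 2 * (Λ - 2 * a * m * ω)))
    (hXl : Xl = ((rPlus M a ^ 2 + a ^ 2) * (ω - m * horizonAngularVelocity M a)) ^ 2 /
      (8 * (rPlus M a - rMinus M a) * (|Λ - 2 * a * m * ω| + 3)))
    (hC : Ccap = (3 * rPlus M a * |ω| * (4 * M * rPlus M a * |ω - m * horizonAngularVelocity M a| +
          3 * rPlus M a * |ω| * (rPlus M a - rMinus M a)) +
          21 * (ω - m * horizonAngularVelocity M a) ^ 2 * rPlus M a ^ 3) / (rPlus M a - rMinus M a) +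
        |Λ - 2 * a * m * ω| + 3)
    (hA : Acap = Ccap / ((rPlus M a ^ 2 + a ^ 2) * |ω - m * horizonAngularVelocity M a|))
    (hε : εc = 2 * |ω - m * horizonAngularVelocity M a| * Real.exp (Acap * Xs))
    (hCA : CA = (2 * rPlus M a) ^ 2 + a ^ 2) (hc : cQ = θ₁ * (Λ - 2 * a * m * ω) / (32 * CA))
    (hr₃ : r₃ = rPlus M a + 131072 * Xs + 2 * εc / cQ) :
    2 * Xs ≤ θ * (rPlus M a - rMinus M a) ∧ Xs ≤ rPlus M a - rMinus M a ∧
    6 * rPlus M a * |ω| * Xl ≤ (rPlus M a ^ 2 + a ^ 2) * |ω - m * horizonAngularVelocity M a| ∧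
    Acap * Xs ≤ 1 ∧
    8 * εc ^ 2 ≤ 131072 * Xs * (rPlus M a - rMinus M a) * (θ₁ * (Λ - 2 * a * m * ω)) / (16 * CA ^ 2) ∧
    r₃ ≤ rPlus M a + min (rPlus M a - rMinus M a) (θ₁ * rPlus M a / 8) ∧
    r₃ ≤ rPlus M a + θ * (rPlus M a - rMinus M a) := by
  have haM : |a| ≤ M := le_of_lt hMa
  have hM : 0 < M := hMa.pos
  have hrp : 0 < rPlus M a := rPlus_pos hM a
  have hMr : M ≤ rPlus M a := M_le_rPlus M a
  have hr2M : rPlus M a ≤ 2 * M := rPlus_le_two_mul_self hM.le a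
  have hκ : 0 < surfaceGravity M a := hMa.surfaceGravity_pos
  obtain ⟨hΛ1, hMω, hs1, hs, hΛ', hΛ'3, hP, hd, hT⟩ := sliver_atoms hMa ha hadm hm hε₀ hcone hθ₁.le hBF hσ
  set Λ' := Λ - 2 * a * m * ω with hΛ'def
  set σ := ω - m * horizonAngularVelocity M a with hσdef
  set P := rPlus M a ^ 2 + a ^ 2 with hPdef
  set d := rPlus M a - rMinus M a with hddef
  set T := |P * σ| with hTdef
  have hP0 : 0 < P := by rw [hPdef]; positivity
  have hd0 : 0 < d := by rw [hd]; positivity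
  have hΛ'0 : 0 < Λ' := by linarith only [hΛ', hΛ1]
  have hσa : 0 < |σ| := abs_pos.2 hσ0
  have hTeq : T = P * |σ| := by rw [hTdef, abs_mul, abs_of_pos hP0]
  have hT0 : 0 < T := by rw [hTeq]; positivity
  have hTd : T ≤ ξ₁ * d := hT
  have hPr : rPlus M a ^ 2 ≤ P := by
    rw [hP]; have := mul_le_mul_of_nonneg_right hr2M hrp.le; nlinarith only [this]
  have hdr : d ≤ rPlus M a := by
    rw [hddef]; have := rMinus_nonneg_of_abs_le haM; linarith only [this]
  have ha2 : a ^ 2 ≤ rPlus M a ^ 2 := by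
    have h1 : |a| ≤ rPlus M a := haM.trans hMr
    have h2 := mul_le_mul h1 h1 (abs_nonneg a) hrp.le
    rw [← sq_abs a]; nlinarith only [h2]
  have hrω : rPlus M a * |ω| ≤ 2 * Real.sqrt Λ := by
    have := mul_le_mul_of_nonneg_right hr2M (abs_nonneg ω)
    linarith only [this, hMω]
  have hsΛ : Real.sqrt Λ ≤ Λ := by nlinarith only [hs1, hs]
  have hξ1 : ξ₁ ≤ 1e-18 := hξ₁le.trans (by
    have : θ₁ ^ 4 ≤ 1 := pow_le_one₀ hθ₁.le hθ₁1; linarith only [this])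
  -- `X* = 24T²/(dθ₁²Λ′) ≤ 24ξ₁²d/(θ₁²Λ′)`
  have hXs' : Xs = 24 * T ^ 2 / (d * θ₁ ^ 2 * Λ') := by rw [hXs, hTdef, sq_abs]
  have hXs0 : 0 ≤ Xs := by rw [hXs']; positivity
  have hB₁ : 24 * ξ₁ ^ 2 / (θ₁ ^ 2 * Λ') ≤ 1e-32 * θ₁ ^ 6 * min θ 1 := by
    rw [div_le_iff₀ (by positivity)]
    have hmin0 : 0 ≤ min θ 1 := le_min hθ.le zero_le_one
    have h1 : ξ₁ ^ 2 ≤ (1e-18 * θ₁ ^ 4) * (1e-18 * θ₁ ^ 4 * min θ 1) := by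
      have hm : ξ₁ ≤ 1e-18 * θ₁ ^ 4 * min θ 1 := by
        rcases le_total θ 1 with h | h
        · rw [min_eq_left h]; exact hξ₁θ
        · rw [min_eq_right h, mul_one]; exact hξ₁le
      calc ξ₁ ^ 2 = ξ₁ * ξ₁ := sq ξ₁
        _ ≤ (1e-18 * θ₁ ^ 4) * (1e-18 * θ₁ ^ 4 * min θ 1) := mul_le_mul hξ₁le hm hξ₁ (by positivity)
    have h2 : Λ ≤ 256 * Λ' := by linarith only [hΛ']
    -- `24 ξ₁² ≤ 24e-36 θ₁⁸ min ≤ 1e-32 θ₁⁶ min · θ₁²Λ′` since `θ₁² Λ′ ≥ θ₁² /256` and `θ₁⁸ ≤ θ₁⁸`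
    have h3 : (1:ℝ) ≤ 256 * Λ' := hΛ1.trans h2
    have h4 : θ₁ ^ 8 * min θ 1 ≤ θ₁ ^ 8 * min θ 1 * (256 * Λ') := le_mul_of_one_le_right (by positivity) h3
    have e : 1e-32 * θ₁ ^ 6 * min θ 1 * (θ₁ ^ 2 * Λ') = 1e-32 / 256 * (θ₁ ^ 8 * min θ 1 * (256 * Λ')) := by ring
    rw [e]
    nlinarith only [h1, h4, hmin0, pow_nonneg hθ₁.le 8]
  have hXsle : Xs ≤ 24 * ξ₁ ^ 2 / (θ₁ ^ 2 * Λ') * d := by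
    rw [hXs', div_mul_eq_mul_div, div_le_div_iff₀ (by positivity) (by positivity)]
    have h1 : T ^ 2 ≤ (ξ₁ * d) ^ 2 := pow_le_pow_left₀ hT0.le hTd 2
    have h2 := mul_le_mul_of_nonneg_right h1 (show 0 ≤ 24 * (θ₁ ^ 2 * Λ') by positivity)
    have e : (ξ₁ * d) ^ 2 * (24 * (θ₁ ^ 2 * Λ')) = 24 * ξ₁ ^ 2 * d * (d * θ₁ ^ 2 * Λ') := by ring
    linarith only [h2, e]
  have hmin1 : min θ 1 ≤ 1 := min_le_right _ _
  have hminθ : min θ 1 ≤ θ := min_le_left _ _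
  have hθ6 : θ₁ ^ 6 ≤ 1 := pow_le_one₀ hθ₁.le hθ₁1
  have hmin0 : 0 ≤ min θ 1 := le_min hθ.le zero_le_one
  have hXsd' : Xs ≤ 1e-32 * d := by
    have h1 : 24 * ξ₁ ^ 2 / (θ₁ ^ 2 * Λ') ≤ 1e-32 := by
      refine hB₁.trans ?_
      have := mul_le_mul hθ6 hmin1 hmin0 zero_le_one
      nlinarith only [this]
    exact hXsle.trans (by nlinarith only [h1, hd0])
  have hXsθ' : Xs ≤ 1e-32 * θ * d := by
    have h1 : 24 * ξ₁ ^ 2 / (θ₁ ^ 2 * Λ') ≤ 1e-32 * θ := by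
      refine hB₁.trans ?_
      have := mul_le_mul hθ6 hminθ hmin0 zero_le_one
      nlinarith only [this]
    exact hXsle.trans (by nlinarith only [h1, hd0])
  -- the `K`-condition: `6r₊|ω|X_low ≤ P|σ|`, `X_low = T²/(8d(|Λ′| + 3))`
  have hK : 6 * rPlus M a * |ω| * Xl ≤ P * |σ| := by
    have ePσ : (P * σ) ^ 2 = T ^ 2 := by rw [hTdef, sq_abs]
    rw [hXl, ePσ, ← hTeq]
    have hden : 0 < 8 * d * (|Λ'| + 3) := by positivity
    rw [mul_div_assoc', div_le_iff₀ hden]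
    have h1 : 6 * rPlus M a * |ω| * T ≤ 8 * d * Λ' := by
      have h3 : rPlus M a * |ω| * T ≤ 2 * Real.sqrt Λ * (ξ₁ * d) := mul_le_mul hrω hTd hT0.le (by positivity)
      have h4 : Real.sqrt Λ * ξ₁ ≤ Λ' / 2 := by
        have := mul_le_mul hsΛ hξ1 hξ₁ (by linarith only [hΛ1])
        linarith only [this, hΛ', hΛ1]
      have h5 := mul_le_mul_of_nonneg_right h4 hd0.le
      have hp : 0 ≤ Λ' * d := by positivity
      linarith only [h3, h5, hp]
    have h2 : Λ' ≤ |Λ'| + 3 := by have := le_abs_self Λ'; linarith only [this]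
    calc 6 * rPlus M a * |ω| * T ^ 2 = (6 * rPlus M a * |ω| * T) * T := by ring
      _ ≤ (8 * d * Λ') * T := mul_le_mul_of_nonneg_right h1 hT0.le
      _ ≤ T * (8 * d * (|Λ'| + 3)) := by
          have := mul_le_mul_of_nonneg_left h2 (show 0 ≤ 8 * d * T by positivity)
          nlinarith only [this]
  -- `A_cap X* = 24 C_cap T/(dθ₁²Λ′) ≤ 1`
  have hR₀ : (3 * rPlus M a * |ω| * (4 * M * rPlus M a * |σ| + 3 * rPlus M a * |ω| * d) +
      21 * σ ^ 2 * rPlus M a ^ 3) / d ≤ 37 * Λ := by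
    rw [div_le_iff₀ hd0]
    have h4 : 4 * M * rPlus M a * |σ| = 2 * T := by rw [hTeq, hP]; ring
    rw [h4]
    have h5 : 21 * σ ^ 2 * rPlus M a ^ 3 ≤ 21 * ξ₁ ^ 2 * d := by
      have e : σ ^ 2 = T ^ 2 / P ^ 2 := by rw [hTeq]; field_simp; rw [sq_abs]
      rw [e]
      have h6 : T ^ 2 / P ^ 2 * rPlus M a ^ 3 ≤ T ^ 2 / rPlus M a := by
        rw [div_mul_eq_mul_div, div_le_div_iff₀ (by positivity) hrp]
        have h8 : rPlus M a ^ 4 ≤ P ^ 2 := by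
          have := pow_le_pow_left₀ (by positivity) hPr 2
          have e : (rPlus M a ^ 2) ^ 2 = rPlus M a ^ 4 := by ring
          linarith only [this, e]
        have := mul_le_mul_of_nonneg_left h8 (sq_nonneg T)
        nlinarith only [this]
      have h7 : T ^ 2 / rPlus M a ≤ ξ₁ ^ 2 * d := by
        rw [div_le_iff₀ hrp]
        have h9 : T ^ 2 ≤ (ξ₁ * d) ^ 2 := pow_le_pow_left₀ hT0.le hTd 2
        have h10 : ξ₁ ^ 2 * d * d ≤ ξ₁ ^ 2 * d * rPlus M a :=
          mul_le_mul_of_nonneg_left hdr (by positivity)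
        nlinarith only [h9, h10]
      nlinarith only [h6, h7]
    have h8 : 3 * rPlus M a * |ω| * (2 * T + 3 * rPlus M a * |ω| * d) ≤ (12 * ξ₁ * Real.sqrt Λ + 36 * Λ) * d := by
      have h9 : rPlus M a * |ω| * T ≤ 2 * Real.sqrt Λ * (ξ₁ * d) := mul_le_mul hrω hTd hT0.le (by positivity)
      have h10 : (rPlus M a * |ω|) ^ 2 ≤ (2 * Real.sqrt Λ) ^ 2 := pow_le_pow_left₀ (by positivity) hrω 2
      rw [mul_pow, mul_pow, hs] at h10
      have h11 := mul_le_mul_of_nonneg_right h10 hd0.le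
      linarith only [h9, h11]
    have h12 : 12 * ξ₁ * Real.sqrt Λ + 36 * Λ + 21 * ξ₁ ^ 2 ≤ 37 * Λ := by
      have t1 : ξ₁ * Real.sqrt Λ ≤ 1e-18 * Λ := by
        have := mul_le_mul hξ1 hsΛ (by linarith only [hs1]) (by norm_num)
        linarith only [this]
      have t2 : ξ₁ ^ 2 ≤ 1e-18 := by nlinarith only [hξ1, hξ₁]
      linarith only [t1, t2, hΛ1]
    nlinarith only [h5, h8, h12, hd0]
  have hCcap : Ccap ≤ 43 * Λ := by rw [hC]; linarith only [hR₀, hΛ'3, hΛ1]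
  have hCcap0 : 0 ≤ Ccap := by rw [hC]; positivity
  have hn1 : Acap * Xs ≤ 1 := by
    rw [hA, hXs', ← hTeq]
    have e : Ccap / T * (24 * T ^ 2 / (d * θ₁ ^ 2 * Λ')) = 24 * Ccap * T / (d * θ₁ ^ 2 * Λ') := by
      field_simp
    rw [e, div_le_one (by positivity)]
    have h1 : 1032 * ξ₁ * Λ ≤ θ₁ ^ 2 * Λ' := by
      have h3 : 1032 * 256 * ξ₁ ≤ θ₁ ^ 2 := by
        have hθ2 : θ₁ ^ 4 ≤ θ₁ ^ 2 := pow_le_pow_of_le_one hθ₁.le hθ₁1 (by norm_num)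
        linarith only [hξ₁le, hθ2, sq_nonneg θ₁]
      have h4 := mul_le_mul h3 hΛ' (by positivity) (by positivity)
      nlinarith only [h4]
    calc 24 * Ccap * T ≤ 24 * (43 * Λ) * (ξ₁ * d) := by gcongr
      _ = (1032 * ξ₁ * Λ) * d := by ring
      _ ≤ d * θ₁ ^ 2 * Λ' := by
          have := mul_le_mul_of_nonneg_right h1 hd0.le; nlinarith only [this]
  -- `ε_c ≤ 6|σ|`
  have hεle : εc ≤ 6 * |σ| := by
    rw [hε]
    have h1 : Real.exp (Acap * Xs) ≤ Real.exp 1 := Real.exp_le_exp.2 hn1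
    have h2 : Real.exp 1 ≤ 3 := by have := Real.exp_one_lt_d9; linarith only [this]
    have h3 := mul_le_mul_of_nonneg_left (h1.trans h2) (show 0 ≤ 2 * |σ| by positivity)
    linarith only [h3]
  have hε0 : 0 ≤ εc := by rw [hε]; positivity
  -- `C_A ≤ 5P`
  have hCA0 : 0 < CA := by rw [hCA]; positivity
  have hCAP : CA ≤ 5 * P := by rw [hCA]; nlinarith only [ha2, hPr]
  have hn3 : 8 * εc ^ 2 ≤ 131072 * Xs * d * (θ₁ * Λ') / (16 * CA ^ 2) := by
    have e : 131072 * Xs * d * (θ₁ * Λ') / (16 * CA ^ 2) = 196608 * T ^ 2 / (θ₁ * CA ^ 2) := by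
      rw [hXs']; field_simp; norm_num
    rw [e, le_div_iff₀ (by positivity)]
    have h1 : εc ^ 2 ≤ (6 * |σ|) ^ 2 := pow_le_pow_left₀ hε0 hεle 2
    have h2 : T ^ 2 = P ^ 2 * |σ| ^ 2 := by rw [hTeq]; ring
    have h3 : CA ^ 2 ≤ 25 * P ^ 2 := by
      have := pow_le_pow_left₀ hCA0.le hCAP 2; nlinarith only [this]
    -- `8ε² θ₁ C_A² ≤ 288σ²·25P² = 7200 P²σ² ≤ 196608 P²σ²`
    have h4 : 8 * εc ^ 2 * (θ₁ * CA ^ 2) ≤ 8 * (6 * |σ|) ^ 2 * (1 * (25 * P ^ 2)) :=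
      mul_le_mul (by linarith only [h1]) (mul_le_mul hθ₁1 h3 (by positivity) zero_le_one) (by positivity)
        (by positivity)
    rw [h2]
    have hp : 0 ≤ P ^ 2 * |σ| ^ 2 := by positivity
    nlinarith only [h4, hp]
  -- `r₃ − r₊ ≤ 131072 X* + 1920 ξ₁ d/(θ₁Λ′)`
  have hcQ0 : 0 < cQ := by rw [hc]; positivity
  have hgain : 2 * εc / cQ ≤ 1920 * ξ₁ * d / (θ₁ * Λ') := by
    rw [hc, div_div_eq_mul_div, div_le_div_iff₀ (by positivity) (by positivity)]
    -- `2ε·32C_A·θ₁Λ′ ≤ 1920ξ₁ d·θ₁Λ′`: `ε ≤ 6|σ|`, `C_A ≤ 5P`, `P|σ| = T ≤ ξ₁d`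
    have h1 : εc * CA ≤ 6 * |σ| * (5 * P) := mul_le_mul hεle hCAP hCA0.le (by positivity)
    have h2 : |σ| * P = T := by rw [hTeq]; ring
    have h3 : εc * CA ≤ 30 * (ξ₁ * d) := by nlinarith only [h1, h2, hTd]
    have h4 := mul_le_mul_of_nonneg_right h3 (show 0 ≤ θ₁ * Λ' by positivity)
    nlinarith only [h4]
  have h1920 : 1920 * ξ₁ / (θ₁ * Λ') ≤ 4.92e-13 * θ₁ ^ 3 * min θ 1 := by
    rw [div_le_iff₀ (by positivity)]
    have hm : ξ₁ ≤ 1e-18 * θ₁ ^ 4 * min θ 1 := by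
      rcases le_total θ 1 with h | h
      · rw [min_eq_left h]; exact hξ₁θ
      · rw [min_eq_right h, mul_one]; exact hξ₁le
    -- `1920·1e-18 θ₁⁴ min ≤ 4.92e-13 θ₁³ min · θ₁ Λ′` since `256 Λ′ ≥ 1`
    have h3 : (1:ℝ) ≤ 256 * Λ' := by linarith only [hΛ', hΛ1]
    have h4 : θ₁ ^ 4 * min θ 1 ≤ θ₁ ^ 4 * min θ 1 * (256 * Λ') := le_mul_of_one_le_right (by positivity) h3
    have e : 4.92e-13 * θ₁ ^ 3 * min θ 1 * (θ₁ * Λ') = 4.92e-13 / 256 * (θ₁ ^ 4 * min θ 1 * (256 * Λ')) := by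
      ring
    have hX0 : 0 ≤ θ₁ ^ 4 * min θ 1 := by positivity
    rw [e]; nlinarith only [hm, h4, hX0]
  have hr₃le : r₃ - rPlus M a ≤ (1.32e-27 * θ₁ ^ 6 + 4.92e-13 * θ₁ ^ 3) * min θ 1 * d := by
    have h1 : 131072 * Xs ≤ 131072 * (1e-32 * θ₁ ^ 6 * min θ 1) * d := by
      have := hXsle.trans (mul_le_mul_of_nonneg_right hB₁ hd0.le)
      linarith only [this]
    have h2 : 2 * εc / cQ ≤ 4.92e-13 * θ₁ ^ 3 * min θ 1 * d := by
      refine hgain.trans ?_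
      have := mul_le_mul_of_nonneg_right h1920 hd0.le
      calc 1920 * ξ₁ * d / (θ₁ * Λ') = 1920 * ξ₁ / (θ₁ * Λ') * d := by ring
        _ ≤ 4.92e-13 * θ₁ ^ 3 * min θ 1 * d := this
    rw [hr₃]
    have e : rPlus M a + 131072 * Xs + 2 * εc / cQ - rPlus M a = 131072 * Xs + 2 * εc / cQ := by ring
    rw [e]
    have e2 : (1.32e-27 * θ₁ ^ 6 + 4.92e-13 * θ₁ ^ 3) * min θ 1 * d =
        1.32e-27 * θ₁ ^ 6 * min θ 1 * d + 4.92e-13 * θ₁ ^ 3 * min θ 1 * d := by ring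
    rw [e2]
    have h3 : 0 ≤ θ₁ ^ 3 * min θ 1 * d := by positivity
    have h4 : 0 ≤ θ₁ ^ 6 * min θ 1 * d := by positivity
    nlinarith only [h1, h2, h3, h4]
  have hθ3 : θ₁ ^ 3 ≤ 1 := pow_le_one₀ hθ₁.le hθ₁1
  have hθ63 : θ₁ ^ 6 ≤ θ₁ ^ 3 := pow_le_pow_of_le_one hθ₁.le hθ₁1 (by norm_num)
  have hcoef : (1.32e-27 * θ₁ ^ 6 + 4.92e-13 * θ₁ ^ 3) ≤ 6e-13 * θ₁ ^ 3 := by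
    linarith only [hθ63, pow_nonneg hθ₁.le 3]
  have hc0 : 0 ≤ 1.32e-27 * θ₁ ^ 6 + 4.92e-13 * θ₁ ^ 3 := by positivity
  have hr₃d : r₃ - rPlus M a ≤ 6e-13 * θ₁ ^ 3 * d := by
    refine hr₃le.trans ?_
    have := mul_le_mul hcoef hmin1 hmin0 (by positivity)
    have := mul_le_mul_of_nonneg_right this hd0.le
    linarith only [this]
  have hr₃θ : r₃ - rPlus M a ≤ 6e-13 * θ₁ ^ 3 * θ * d := by
    refine hr₃le.trans ?_
    have := mul_le_mul hcoef hminθ hmin0 (by positivity)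
    have := mul_le_mul_of_nonneg_right this hd0.le
    linarith only [this]
  have hθd0 : 0 < θ * d := mul_pos hθ hd0
  refine ⟨by linarith only [hXsθ', hθd0], by linarith only [hXsd', hd0], hK, hn1, hn3, ?_, ?_⟩
  · rw [← sub_le_iff_le_add']
    refine le_min ?_ ?_
    · have : θ₁ ^ 3 * d ≤ 1 * d := mul_le_mul_of_nonneg_right hθ3 hd0.le
      linarith only [hr₃d, this, hd0]
    · -- `6e-13 θ₁³ d ≤ θ₁ r₊/8` since `d ≤ r₊`, `θ₁² ≤ 1`
      have h1 : θ₁ ^ 3 ≤ θ₁ := by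
        have h6 : θ₁ ^ 2 ≤ 1 := pow_le_one₀ hθ₁.le hθ₁1
        have := mul_le_mul_of_nonneg_right h6 hθ₁.le
        have e : θ₁ ^ 2 * θ₁ = θ₁ ^ 3 := by ring
        linarith only [this, e]
      have : θ₁ ^ 3 * d ≤ θ₁ * rPlus M a := mul_le_mul h1 hdr hd0.le hθ₁.le
      have hp : 0 ≤ θ₁ * rPlus M a := by positivity
      linarith only [hr₃d, this, hp]
  · rw [← sub_le_iff_le_add']
    have : θ₁ ^ 3 * θ * d ≤ 1 * θ * d :=
      mul_le_mul_of_nonneg_right (mul_le_mul_of_nonneg_right hθ3 hθ.le) hd0.le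
    linarith only [hr₃θ, this, hθd0]

end SliverCapSmallness

end Kerr

end Literature.Geometry.Lorentzian

end
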